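import Literature.NumberTheory.GaloisRepresentations.GalLayerSystemIhomColimit
import Literature.NumberTheory.GaloisRepresentations.IdeleClassBarLatticeVanishing
import Literature.NumberTheory.GaloisRepresentations.IdeleCohomologySubgroups
import Literature.NumberTheory.GaloisRepresentations.GalLayerSystemSES
import Literature.Algebra.Homology.BrauerGroupInflationRestriction
import Literature.Algebra.Homology.PermutationDualCoinduced
import Literature.Algebra.Homology.DiscreteRepFreePresentation
import HarnessLib

/-!
# `Ext¹_{C_Γ}(Inf ℤ[Γ/U]ⁿ, F̄ˣ) = 0` and `Ext¹_{C_Γ}(Inf ℤ[Γ/U]ⁿ, J̄) = 0`: the module of door-c4's free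
# presentation has no `Ext¹` against the units and the idèles (Hilbert 90 / its idèle form at the layers)

Topic `NumberTheory/GaloisRepresentations`; namespaces `Literature.NumberTheory.GaloisRepresentations.GalLayerData`
(generic) and `….FreePresentation` (the permutation lattice).  Definitions with bodies (the lattice
`presLattice E₀ m = Inf ℤ[Γ_F/U_{E₀}]ᵐ`, an abbreviation of door-c4's object, and the homomorphism `layerHom`)
and theorems; no named fact, no instance, no `sorry`.

THE MATHEMATICS (Milne ADT I, proof of Lemma 1.9 / Lemma 4.13 "Exts commute with products … (0.11)", in the
form needed by the PRESENTATION ROAD of crux `stmt-BirchSwinnertonDyer-19295`).  Let `F` be a number field,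
`Γ = Γ_F`, `E₀/F` a finite Galois layer with `U = Gal(F̄/E₀)`, and `P = Inf ℤ[Γ/U]ᵐ` the first module of
door-c4's free presentation `0 → M₁ → P → M → 0` (`DiscreteRep.freePresentation_shortExact`).  For a Galois
layer system `D` (`E ↦ E^×`, `E ↦ J_E`, …) with limit `lim D ∈ C_Γ`:
`Ext¹_{C_Γ}(P, lim D) ≅ Ext¹_{C_Γ}(ℤ, Hom(P, lim D))` (`extIhomAddEquivOfProjective`, `P` is a lattice)
`= lim→_{E ⊇ E₀} H¹(Gal(E/F), Hom(P, D_E))` (door-c6 g15 `GalLayerSystemIhomColimit`), and at each layer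
`Hom(P, D_E) = Hom(ℤ[β], D_E)` for the `Gal(E/F)`-set `β = Fin m × Gal(E₀/F)` all of whose isotropy groups
are `Gal(E/E₀)`, so `H¹(Gal(E/F), Hom(P, D_E)) ≅ ∏ H¹(Gal(E/E₀), D_E)` (Brown III (5.8) + Shapiro,
`PermutationDual.isZero_groupCohomology_ihom`), which VANISHES for `D_E = E^×` (Hilbert 90 at `E/E₀`,
`InflationRestriction.isZero_H1_res_units`) and for `D_E = J_E` (`IdeleCohomology.isZero_H1_res_ideleRep`).

* §1 (generic) `GalLayerData.ext_triv_ihom_eq_zero_of_forall_isZero`, `…ext_latticeD_eq_zero_of_forall_isZero`: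
  `Extⁿ_{C_Γ}(N, lim D) = 0` for a discrete lattice `N` as soon as EVERY layer `Hⁿ(Gal(E/F), Hom(N_E, D_E))`,
  `E ⊇ E₀`, vanishes; `GalLayerData.isZero_ihom_layer_of_basis` (the layer vanishes when `N` has a basis permuted
  by `Gal(E/F)` with uniform isotropy `K` and `Hⁿ(K, Res D_E) = 0`).
* §2 the lattice `presLattice E₀ m := Inf ℤ[Γ/U_{E₀}]ᵐ`: `trivialOn_presLattice`, the homomorphism
  `layerHom : Gal(E/F) → Γ/U_{E₀}`, its kernel, the permuted basis `presBasis`, and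
  **`isZero_ihom_layer_presLattice`**: `Hⁿ(Gal(E/F), Hom(P, D_E)) = 0` whenever `Hⁿ(ker layerHom, Res D_E) = 0`.
* §3 **`ext_presLattice_unitsBarD_eq_zero`**: `Ext¹_{C_Γ}(Inf ℤ[Γ/U]ᵐ, F̄ˣ) = 0`;
  **`ext_presLattice_ideleBarD_eq_zero`**: `Ext¹_{C_Γ}(Inf ℤ[Γ/U]ᵐ, J̄) = 0` (door-c5's `unitsBarD F`, `ideleBarD F`).

USE.  With `ExtPresentation` (door-c6 g16): the boundary `Hom_Γ(M₁, J̄) → Ext¹(M^D, J̄)` is ONTO and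
`Hom_Γ(P, J̄) → Hom_Γ(P, C̄)` is onto (`comp_g_surjective` with `Ext¹(P, F̄ˣ) = 0`), so Milne's
`Ext¹(M^D, J̄) → Ext¹(M^D, C̄)` chase runs on equivariant homomorphisms out of the relation module.
HONEST FRAMING: no case of Poitou–Tate or BSD is proved here.

## References
* J. S. Milne, *Arithmetic Duality Theorems* (2nd ed. 2006), I §0 (0.8)–(0.11), I Lemma 1.9 (proof),
  I Lemma 4.13 (proof). [MilneADT2006]
* K. S. Brown, *Cohomology of Groups*, GTM 87 (1982), III §5 Prop. (5.8), III §6 Prop. (6.2).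
  [Brown1982CohomologyGroups]
* J.-P. Serre, *Local Fields*, GTM 67 (1979), X §1 Prop. 2 (Hilbert 90). [Serre1979]
-/

noncomputable section

open CategoryTheory CategoryTheory.Limits CategoryTheory.Abelian groupCohomology
open Field (absoluteGaloisGroup)
open Literature.Algebra.Homology
open scoped Classical

namespace Literature.NumberTheory.GaloisRepresentations

open IdeleClassBar

/-! ## §1 Generic: layers vanish ⟹ `Extⁿ_{C_Γ}(N, lim D) = 0` -/

namespace GalLayerData

variable {F : Type} [Field F] [NumberField F] (D : GalLayerData F)
variable {V : Type} [AddCommGroup V] (ρN : Representation ℤ (absoluteGaloisGroup F) V)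
  (hρN : DiscreteRep.IsDiscrete (Rep.of ρN)) [Module.Finite ℤ V]

/-- **`Extⁿ_{C_Γ}(ℤ, Hom(N, lim D)) = 0` when every trivialising layer `Hⁿ(Gal(E/F), Hom(N_E, D_E))` vanishes**
(door-c6 g15's vanishing transfer with the killing layer `M = E`). [cite: MilneADT2006, I Lemma 1.9 (proof)] -/
theorem ext_triv_ihom_eq_zero_of_forall_isZero {E₀ : GalLayer F} (hE₀ : TrivialOn ρN E₀) (n : ℕ)
    (h : ∀ (E : GalLayer F) (h₀ : E₀ ≤ E),
      IsZero (groupCohomology ((Rep.ihom (coeff ρN (hE₀.mono h₀))).obj (D.obj E)) n))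
    (x : Abelian.Ext (DiscreteRep.triv (Γ := absoluteGaloisGroup F) ℤ)
      (DiscreteRep.ihomObj (latticeD ρN hρN) D.toSystem.toD) n) : x = 0 :=
  D.ext_triv_ihom_eq_zero_of_forall_exists_ihomInf_eq_zero ρN hρN hE₀ n (fun E h₀ c => by
    haveI := ModuleCat.subsingleton_of_isZero (h E h₀)
    exact ⟨E, le_rfl, by rw [Subsingleton.elim c 0, map_zero]⟩) x

variable [Module.Free ℤ V]

/-- **`Extⁿ_{C_Γ}(N, lim D) = 0` for a discrete lattice `N` when every layer `Hⁿ(Gal(E/F), Hom(N_E, D_E))`,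
`E ⊇ E₀`, vanishes** (`Extⁿ(N, ·) ≃ Extⁿ(ℤ, Hom(N, ·))`, Harari 16.16 (b), on the discrete presentation).
[cite: MilneADT2006, I Lemma 1.9 (proof)][cite: Brown1982CohomologyGroups, III §6 Prop. (6.2)] -/
theorem ext_latticeD_eq_zero_of_forall_isZero {E₀ : GalLayer F} (hE₀ : TrivialOn ρN E₀) (n : ℕ)
    (h : ∀ (E : GalLayer F) (h₀ : E₀ ≤ E),
      IsZero (groupCohomology ((Rep.ihom (coeff ρN (hE₀.mono h₀))).obj (D.obj E)) n))
    (x : Abelian.Ext (latticeD ρN hρN) D.toSystem.toD n) : x = 0 := by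
  haveI : DiscreteTopology (discTopRep D.toSystem.toD).V := discreteTopology_discTopRep _
  have h' := D.ext_triv_ihom_eq_zero_of_forall_isZero ρN hρN hE₀ n h
    (DiscreteRep.extIhomAddEquivOfProjective (latticeD ρN hρN) (discTopRep D.toSystem.toD)
      (isDiscrete_discTopRep D.toSystem.toD) n x)
  exact (map_eq_zero_iff _ (DiscreteRep.extIhomAddEquivOfProjective (latticeD ρN hρN)
    (discTopRep D.toSystem.toD) (isDiscrete_discTopRep D.toSystem.toD) n).injective).1 h'

omit [Module.Finite ℤ V] [Module.Free ℤ V] in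
/-- **A layer `Hⁿ(Gal(E/F), Hom(N_E, D_E))` vanishes when `N` has a `ℤ`-basis permuted by `Gal(E/F)` with all
isotropy groups equal to one subgroup `K` and `Hⁿ(K, Res_K D_E) = 0`** (Brown III (5.8) + Shapiro:
`PermutationDual.isZero_groupCohomology_ihom`). [cite: Brown1982CohomologyGroups, III §5 Prop. (5.8)] -/
theorem isZero_ihom_layer_of_basis {E : GalLayer F} (hE : TrivialOn ρN E) {β : Type}
    [MulAction (E.1 ≃ₐ[F] E.1) β] (K : Subgroup (E.1 ≃ₐ[F] E.1))
    (hstab : ∀ b : β, MulAction.stabilizer (E.1 ≃ₐ[F] E.1) b = K) (e : Module.Basis β ℤ V)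
    (he : ∀ (σ : E.1 ≃ₐ[F] E.1) (i : β), coeffRep ρN hE σ (e i) = e (σ • i)) (n : ℕ)
    (hX : IsZero (groupCohomology (Rep.res K.subtype (D.obj E)) n)) :
    IsZero (groupCohomology ((Rep.ihom (coeff ρN hE)).obj (D.obj E)) n) :=
  PermutationDual.isZero_groupCohomology_ihom (D.obj E) K hstab (A := coeff ρN hE) e he n hX

end GalLayerData

/-! ## §2 The permutation lattice `Inf ℤ[Γ/U_{E₀}]ᵐ` of door-c4's free presentation -/

namespace FreePresentation

variable {F : Type} [Field F] [NumberField F] (E₀ : GalLayer F) (m : ℕ)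

/-- **`P = Inf ℤ[Γ_F/U_{E₀}]ᵐ`**, the first module of door-c4's free presentation
`0 → M₁ → Inf ℤ[Γ/U]ᵐ → M → 0` (`DiscreteRep.freePresentation_shortExact`) at the layer `E₀`.
[cite: MilneADT2006, I Lemma 1.9 (proof)] -/
abbrev presLattice : DiscreteRepCat ℤ (absoluteGaloisGroup F) :=
  (DiscreteRep.infFunctor ℤ (E₀.openNormalSubgroup : Subgroup (absoluteGaloisGroup F))
    (DiscreteRep.LayerColimit.coe_isOpen E₀.openNormalSubgroup)).obj
    (Rep.free ℤ (absoluteGaloisGroup F ⧸ (E₀.openNormalSubgroup : Subgroup (absoluteGaloisGroup F))) (Fin m))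

omit [NumberField F] in
/-- The action on `P`: `σ · x = [σ] · x` (left translation by the class of `σ` in `Γ/U_{E₀}`).
[cite: MilneADT2006, I Lemma 1.9 (proof)] -/
theorem presLattice_ρ_apply (σ : absoluteGaloisGroup F) (x : (presLattice E₀ m).obj.V) :
    (presLattice E₀ m).obj.ρ σ x =
      Representation.free ℤ (absoluteGaloisGroup F ⧸ (E₀.openNormalSubgroup : Subgroup (absoluteGaloisGroup F)))
        (Fin m) (QuotientGroup.mk σ) x := rfl

omit [NumberField F] in
/-- `U_{E₀}` acts trivially on `P`. [cite: MilneADT2006, I Lemma 1.9 (proof)] -/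
theorem trivialOn_presLattice : TrivialOn (presLattice E₀ m).obj.ρ E₀ := by
  intro σ hσ x
  have h1 : (QuotientGroup.mk σ :
      absoluteGaloisGroup F ⧸ (E₀.openNormalSubgroup : Subgroup (absoluteGaloisGroup F))) = 1 :=
    (QuotientGroup.eq_one_iff σ).mpr hσ
  change Representation.free ℤ _ (Fin m) (QuotientGroup.mk σ) x = x
  rw [h1, map_one, Module.End.one_apply]

omit [NumberField F] in
/-- `P` has open stabilisers. [cite: MilneADT2006, I Lemma 1.9 (proof)] -/
theorem isDiscrete_presLattice : DiscreteRep.IsDiscrete (Rep.of (presLattice E₀ m).obj.ρ) :=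
  (presLattice E₀ m).property

/-- **`Gal(E/F) → Γ/U_{E₀}`** for a layer `E ⊇ E₀`: `τ ↦ [τ̃]` (restriction to `E₀` followed by
`Gal(E₀/F) ≅ Γ/U_{E₀}`). [cite: SerreGaloisCohomology1997, I §2.2] -/
def layerHom {E : GalLayer F} (h₀ : E₀ ≤ E) :
    (E.1 ≃ₐ[F] E.1) →* absoluteGaloisGroup F ⧸ (E₀.openNormalSubgroup : Subgroup (absoluteGaloisGroup F)) :=
  E₀.quotEquiv.symm.toMonoidHom.comp (GalLayer.resHom h₀)

/-- `layerHom (σ|_E) = [σ]`. [cite: SerreGaloisCohomology1997, I §2.2] -/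
@[simp]
theorem layerHom_restrictHom {E : GalLayer F} (h₀ : E₀ ≤ E) (σ : absoluteGaloisGroup F) :
    layerHom E₀ h₀ (E.restrictHom σ) = QuotientGroup.mk σ := by
  rw [layerHom, MonoidHom.comp_apply, GalLayer.resHom_restrictHom, MulEquiv.coe_toMonoidHom,
    GalLayer.quotEquiv_symm_restrictHom]

/-- The `Gal(E/F)`-set `Γ/U_{E₀}` (left translation through `layerHom`) — a definition to be installed
locally with `letI`, never a global instance. [cite: Brown1982CohomologyGroups, III §5] -/
@[reducible]
def quotAction {E : GalLayer F} (h₀ : E₀ ≤ E) :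
    MulAction (E.1 ≃ₐ[F] E.1) (absoluteGaloisGroup F ⧸ (E₀.openNormalSubgroup : Subgroup (absoluteGaloisGroup F))) :=
  MulAction.compHom _ (layerHom E₀ h₀)

/-- Under `quotAction`, `τ • q = layerHom τ * q`. [cite: Brown1982CohomologyGroups, III §5] -/
theorem quotAction_smul {E : GalLayer F} (h₀ : E₀ ≤ E) (τ : E.1 ≃ₐ[F] E.1)
    (q : absoluteGaloisGroup F ⧸ (E₀.openNormalSubgroup : Subgroup (absoluteGaloisGroup F))) :
    (letI := quotAction E₀ h₀; τ • q) = layerHom E₀ h₀ τ * q := rfl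

/-- Every isotropy group of the `Gal(E/F)`-set `Fin m × Γ/U_{E₀}` is `ker layerHom = Gal(E/E₀)`.
[cite: Brown1982CohomologyGroups, III §5 Prop. (5.8)] -/
theorem stabilizer_eq_ker {E : GalLayer F} (h₀ : E₀ ≤ E)
    (b : Σ _ : Fin m, absoluteGaloisGroup F ⧸ (E₀.openNormalSubgroup : Subgroup (absoluteGaloisGroup F))) :
    (letI := quotAction E₀ h₀; MulAction.stabilizer (E.1 ≃ₐ[F] E.1) b) = (layerHom E₀ h₀).ker := by
  letI := quotAction E₀ h₀
  ext τ
  rw [MulAction.mem_stabilizer_iff, MonoidHom.mem_ker]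
  obtain ⟨i, q⟩ := b
  rw [Sigma.smul_mk, Sigma.mk.injEq, quotAction_smul]
  simp only [heq_eq_eq, true_and]
  exact mul_eq_right

/-- **The standard basis of `ℤ[Γ/U]ᵐ`**, `⟨i, q⟩ ↦ eᵢ ⊗ [q]`, indexed by `Fin m × Γ/U_{E₀}`.
[cite: MilneADT2006, I Lemma 1.9 (proof)] -/
def presBasis :
    Module.Basis (Σ _ : Fin m, absoluteGaloisGroup F ⧸ (E₀.openNormalSubgroup : Subgroup (absoluteGaloisGroup F)))
      ℤ (presLattice E₀ m).obj.V :=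
  Finsupp.basis fun _ : Fin m =>
    MonoidAlgebra.basis (absoluteGaloisGroup F ⧸ (E₀.openNormalSubgroup : Subgroup (absoluteGaloisGroup F))) ℤ

omit [NumberField F] in
/-- `presBasis ⟨i, q⟩ = single i (single q 1)`. [cite: MilneADT2006, I Lemma 1.9 (proof)] -/
theorem presBasis_apply (i : Fin m)
    (q : absoluteGaloisGroup F ⧸ (E₀.openNormalSubgroup : Subgroup (absoluteGaloisGroup F))) :
    presBasis E₀ m ⟨i, q⟩ = Finsupp.single i (MonoidAlgebra.single q (1 : ℤ)) :=
  (congrFun (Finsupp.coe_basis _) (⟨i, q⟩ : Σ _ : Fin m, _)).trans rfl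

/-- The basis is permuted: `τ · e⟨i, q⟩ = e⟨i, layerHom τ · q⟩` (descended action at a layer `E ⊇ E₀`).
[cite: Brown1982CohomologyGroups, III §5 Prop. (5.8)] -/
theorem coeffRep_presBasis {E : GalLayer F} (h₀ : E₀ ≤ E) (τ : E.1 ≃ₐ[F] E.1)
    (b : Σ _ : Fin m, absoluteGaloisGroup F ⧸ (E₀.openNormalSubgroup : Subgroup (absoluteGaloisGroup F))) :
    coeffRep (presLattice E₀ m).obj.ρ ((trivialOn_presLattice E₀ m).mono h₀) τ (presBasis E₀ m b) =
      presBasis E₀ m (letI := quotAction E₀ h₀; τ • b) := by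
  letI := quotAction E₀ h₀
  obtain ⟨σ, rfl⟩ := E.restrictHom_surjective τ
  obtain ⟨i, q⟩ := b
  rw [coeffRep_restrictHom, Sigma.smul_mk, quotAction_smul, layerHom_restrictHom, presBasis_apply,
    presBasis_apply]
  exact Representation.free_single_single _ _ _ _

variable (D : GalLayerData F)

/-- **`Hⁿ(Gal(E/F), Hom(P, D_E)) = 0` for `E ⊇ E₀` as soon as `Hⁿ(Gal(E/E₀), Res D_E) = 0`**
(`Gal(E/E₀) = ker layerHom`). [cite: Brown1982CohomologyGroups, III §5 Prop. (5.8)][cite: MilneADT2006, I Lemma 1.9 (proof)] -/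
theorem isZero_ihom_layer_presLattice {E : GalLayer F} (h₀ : E₀ ≤ E) (n : ℕ)
    (hX : IsZero (groupCohomology (Rep.res (layerHom E₀ h₀).ker.subtype (D.obj E)) n)) :
    IsZero (groupCohomology
      ((Rep.ihom (coeff (presLattice E₀ m).obj.ρ ((trivialOn_presLattice E₀ m).mono h₀))).obj (D.obj E)) n) := by
  letI := quotAction E₀ h₀
  exact D.isZero_ihom_layer_of_basis (presLattice E₀ m).obj.ρ ((trivialOn_presLattice E₀ m).mono h₀)
    (layerHom E₀ h₀).ker (stabilizer_eq_ker E₀ m h₀) (presBasis E₀ m) (coeffRep_presBasis E₀ m h₀) n hX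

/-- `P` is a finitely generated free `ℤ`-module (for the `ℤ`-structure it carries).
[cite: MilneADT2006, I Lemma 1.9 (proof)] -/
theorem moduleFinite_presLattice : Module.Finite ℤ (presLattice E₀ m).obj.V :=
  Module.Finite.of_basis (presBasis E₀ m)

omit [NumberField F] in
/-- `P` is `ℤ`-free. [cite: MilneADT2006, I Lemma 1.9 (proof)] -/
theorem moduleFree_presLattice : Module.Free ℤ (presLattice E₀ m).obj.V :=
  Module.Free.of_basis (presBasis E₀ m)

/-- **`Extⁿ_{C_Γ}(P, lim D) = 0` whenever `Hⁿ(Gal(E/E₀), Res D_E) = 0` at every layer `E ⊇ E₀`.**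
[cite: MilneADT2006, I Lemma 1.9 (proof), I Lemma 4.13 (proof)] -/
theorem ext_presLattice_eq_zero (n : ℕ)
    (hX : ∀ (E : GalLayer F) (h₀ : E₀ ≤ E),
      IsZero (groupCohomology (Rep.res (layerHom E₀ h₀).ker.subtype (D.obj E)) n))
    (x : Abelian.Ext (presLattice E₀ m) D.toSystem.toD n) : x = 0 :=
  haveI := moduleFinite_presLattice E₀ m
  haveI := moduleFree_presLattice E₀ m
  D.ext_latticeD_eq_zero_of_forall_isZero (presLattice E₀ m).obj.ρ (isDiscrete_presLattice E₀ m)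
    (trivialOn_presLattice E₀ m) n (fun E h₀ => isZero_ihom_layer_presLattice E₀ m D h₀ n (hX E h₀)) x

/-! ## §3 The units and the idèles -/

/-- **`Ext¹_{C_Γ}(Inf ℤ[Γ/U_{E₀}]ᵐ, F̄ˣ) = 0`** (`F̄ˣ = lim→ E^×` = door-c5's `unitsBarD F`): Hilbert 90
`H¹(Gal(E/E₀), E^×) = 0` at every layer. [cite: Serre1979, X §1 Prop. 2][cite: MilneADT2006, I Lemma 4.13 (proof)] -/
theorem ext_presLattice_unitsBarD_eq_zero (x : Abelian.Ext (presLattice E₀ m) (unitsBarD F) 1) : x = 0 :=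
  ext_presLattice_eq_zero E₀ m (unitsData F) 1 (fun E h₀ => by
    haveI := E.numberField
    haveI := E.isGalois
    exact InflationRestriction.isZero_H1_res_units F E.1 (layerHom E₀ h₀).ker) x

/-- **`Ext¹_{C_Γ}(Inf ℤ[Γ/U_{E₀}]ᵐ, J̄) = 0`** (`J̄ = lim→ J_E` = door-c5's `ideleBarD F`): the idèle Hilbert 90
`H¹(Gal(E/E₀), J_E) = 0` at every layer. [cite: MilneADT2006, I Lemma 4.13 (proof)][cite: Serre1979, X §1 Prop. 2] -/
theorem ext_presLattice_ideleBarD_eq_zero (x : Abelian.Ext (presLattice E₀ m) (ideleBarD F) 1) : x = 0 :=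
  ext_presLattice_eq_zero E₀ m (ideleData F) 1 (fun E h₀ => by
    haveI := E.numberField
    haveI := E.isGalois
    exact IdeleCohomology.isZero_H1_res_ideleRep (F := F) (E := E.1) (layerHom E₀ h₀).ker) x

end FreePresentation

end Literature.NumberTheory.GaloisRepresentations

end
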